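import Mathlib.Geometry.Manifold.Instances.Sphere
import Mathlib.Analysis.InnerProductSpace.Calculus
import Literature.Topology.FourManifolds.CircleSurgery
import Literature.Topology.FourManifolds.ClosedBall
import Literature.Topology.FourManifolds.GluingConstruction
import Literature.Topology.FourManifolds.SmoothEmbeddingCriteria
import HarnessLib

/-!
# Circle surgery along a tubular neighbourhood: the construction

Given a closed smooth 4-manifold `X` (charted on `ℝ⁴`), a circle `c : 𝕊¹ → X` and a tubular
neighbourhood `ν : CircleNbhd (𝓡 4) c` (an open smooth embedding `𝕊¹ × ℝ³ ↪ X` with zero section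
`c`, `Literature.Topology.FourManifolds.CircleSurgery`), this file constructs the surgered manifold
`P = (X ∖ ν(𝕊¹ × B³)) ∪_{𝕊¹ × 𝕊²} (D² × 𝕊²)` as the open gluing (`Literature.Topology.FourManifolds.SmoothGlueData.Glued` of
`Literature.Topology.FourManifolds.GluingConstruction`) of `X ∖ c(𝕊¹)` and `D̊² × 𝕊²` along the
polar identification `ν (u, w) ↦ (‖w‖ • u, w / ‖w‖)` (`0 < ‖w‖ < 1`), whose graph is exactly
`Literature.circleSurgeryRel ν`, and proves that `P` is a closed (compact, Hausdorff, second countable)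
smooth 4-manifold (Gompf–Stipsicz, *4-Manifolds and Kirby Calculus* (1999), §5.2; Kosinski,
*Differential Manifolds* (1993), VI.1–2). This is the constructive content of the named fact
`Literature.Topology.FourManifolds.exists_isOpenGluing_circleSurgeryRel` of
`Literature.Topology.FourManifolds.CircleSurgeryProofs`, discharged there from
`Literature.Topology.FourManifolds.CircleNbhd.surgery_exists` below.

## Main definitions and results

* `Literature.Topology.FourManifolds.contMDiffOn_radialProjection` (smoothness of the tree's `Literature.Topology.FourManifolds.radialProjection` of
  `ClosedBall.lean` off the origin), `Literature.Topology.FourManifolds.polar`, `Literature.Topology.FourManifolds.polarInv`: the polar identification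
  `𝕊¹ × (ℝ³ ∖ 0) ≅ (ℝ² ∖ 0) × 𝕊²`, with smoothness.
* `Literature.CircleNbhd.glue ν : (X ∖ c) ⇀ D̊² × 𝕊²`, the gluing partial diffeomorphism (source the
  punctured tube, target `{p | p.1 ≠ 0}`), `Literature.Topology.FourManifolds.CircleNbhd.circleSurgeryRel_iff`: its graph is
  `circleSurgeryRel ν`; `Literature.CircleNbhd.glueData ν`, `Literature.CircleNbhd.Surgered ν` (the pushout)
  with its `T2Space` (closed graph, via the compact parametrisation `𝕊¹ × [0, 1] × 𝕊²`),
  `CompactSpace` (cover by `X ∖ ν(𝕊¹ × B³_{1/2})` and `D²_{1/2} × 𝕊²`) and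
  `SecondCountableTopology` instances.
* `Literature.Topology.FourManifolds.CircleNbhd.isOpenGluing_surgered`, `Literature.Topology.FourManifolds.CircleNbhd.surgery_exists`: `Surgered ν` is an
  open gluing of `X ∖ c` and `D̊² × 𝕊²` along `circleSurgeryRel ν`.

Everything here is proved; tags are `[folklore]` except the final packaged statement.
-/

open scoped Manifold ContDiff Topology
open Set Function Metric

noncomputable section

namespace Literature.Topology.FourManifolds

universe u

/-- Local notation: `𝔼 n` is the model Euclidean space `EuclideanSpace ℝ (Fin n)`. -/
local notation "𝔼 " n:arg => EuclideanSpace ℝ (Fin n)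

/-- Local notation: `𝕊 n` is the unit sphere in `EuclideanSpace ℝ (Fin (n + 1))`. -/
local notation "𝕊 " n:arg => (Metric.sphere (0 : EuclideanSpace ℝ (Fin (n + 1))) 1)

attribute [local instance] fact_finrank_euclideanSpace_succ

/-! ### Smoothness on open subsets: passing between `ContMDiffOn` and the open submanifold -/

section OpensHelpers

variable {EM HM : Type*} [NormedAddCommGroup EM] [NormedSpace ℝ EM] [TopologicalSpace HM]
  {IM : ModelWithCorners ℝ EM HM} {M : Type*} [TopologicalSpace M] [ChartedSpace HM M]
  {EM' HM' : Type*} [NormedAddCommGroup EM'] [NormedSpace ℝ EM'] [TopologicalSpace HM']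
  {IM' : ModelWithCorners ℝ EM' HM'} {M' : Type*} [TopologicalSpace M'] [ChartedSpace HM' M']
  {n : WithTop ℕ∞}

/-- A map is `C^n` on an open set `U` iff its restriction to the open submanifold `U` is `C^n`. [folklore] -/
theorem contMDiffOn_iff_contMDiff_opens {U : TopologicalSpace.Opens M} {g : M → M'} :
    ContMDiffOn IM IM' n g U ↔ ContMDiff IM IM' n fun x : U ↦ g x := by
  constructor
  · intro h x
    exact contMDiffAt_subtype_iff.2 (h.contMDiffAt (U.isOpen.mem_nhds x.2))
  · intro h x hx
    exact (contMDiffAt_subtype_iff.1 (h ⟨x, hx⟩)).contMDiffWithinAt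

end OpensHelpers

/-! ### Normalisation to the unit sphere -/

section UnitVec

variable {n : ℕ}

/-- The point `e₀` of the unit sphere `𝕊ⁿ ⊆ ℝⁿ⁺¹` (a base point, used as a junk value). [folklore] -/
def spherePt (n : ℕ) : 𝕊 n := ⟨EuclideanSpace.single 0 1, by simp⟩

/-- The unit spheres `𝕊ⁿ ⊆ ℝⁿ⁺¹` are nonempty (Mathlib has only the lemma
`NormedSpace.sphere_nonempty`, no instance; needed for `[Nonempty (𝕊¹ × ℝ³)]` arguments). [folklore] -/
instance nonempty_unitSphere : Nonempty (𝕊 n) := ⟨spherePt n⟩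

/-- **The radial projection is smooth away from the origin** (`w ↦ w/‖w‖` is real-analytic on
`ℝⁿ⁺¹ ∖ 0` and lands in the sphere, an embedded submanifold): the `C^∞` upgrade of
`continuousOn_radialProjection` for the tree's `Literature.radialProjection p`
(`Literature.Topology.FourManifolds.ClosedBall`, junk value `p` at the origin). [folklore] -/
theorem contMDiffOn_radialProjection (p : 𝕊 n) :
    ContMDiffOn 𝓘(ℝ, 𝔼 (n + 1)) (𝓡 n) ∞ (radialProjection p) {w | w ≠ 0} := by
  let U : TopologicalSpace.Opens (𝔼 (n + 1)) := ⟨{w | w ≠ 0}, isOpen_ne⟩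
  change ContMDiffOn 𝓘(ℝ, 𝔼 (n + 1)) (𝓡 n) ∞ (radialProjection p) (U : Set (𝔼 (n + 1)))
  rw [contMDiffOn_iff_contMDiff_opens]
  have h1 : ContMDiff 𝓘(ℝ, 𝔼 (n + 1)) 𝓘(ℝ, 𝔼 (n + 1)) ∞
      fun w : U ↦ ‖(w : 𝔼 (n + 1))‖⁻¹ • (w : 𝔼 (n + 1)) := by
    intro w
    have hw : (w : 𝔼 (n + 1)) ≠ 0 := w.2
    exact (contMDiffAt_subtype_iff (f := fun w : 𝔼 (n + 1) ↦ ‖w‖⁻¹ • w)).2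
      (((contDiffAt_norm ℝ hw).inv (norm_ne_zero_iff.2 hw)).smul contDiffAt_id).contMDiffAt
  have h2 : ∀ w : U, ‖(w : 𝔼 (n + 1))‖⁻¹ • (w : 𝔼 (n + 1)) ∈ sphere (0 : 𝔼 (n + 1)) 1 := fun w ↦ by
    have hw : (w : 𝔼 (n + 1)) ≠ 0 := w.2
    simp [norm_smul, inv_mul_cancel₀ (norm_ne_zero_iff.2 hw)]
  have heq : (fun w : U ↦ radialProjection p (w : 𝔼 (n + 1))) = Set.codRestrict _ _ h2 := by
    funext w
    ext1
    exact coe_radialProjection_of_ne_zero p w.2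
  rw [heq]
  exact h1.codRestrict_sphere h2

end UnitVec

/-! ### The gluing datum of a circle surgery -/

section Datum



variable {X : Type u} [TopologicalSpace X] [ChartedSpace (𝔼 4) X] {c : 𝕊 1 → X}
  (ν : CircleNbhd (𝓡 4) c)

namespace CircleNbhd

/-- A tubular neighbourhood map is an open embedding. [folklore] -/
protected theorem isOpenEmbedding : Topology.IsOpenEmbedding ν.toFun :=
  ⟨ν.isSmoothEmbedding.isEmbedding, ν.isOpen_range⟩

/-- A tubular neighbourhood map is injective. [folklore] -/
protected theorem injective : Injective ν.toFun := ν.isSmoothEmbedding.isEmbedding.injective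

/-- A tubular neighbourhood map is smooth. [folklore] -/
protected theorem contMDiff : ContMDiff ((𝓡 1).prod 𝓘(ℝ, 𝔼 3)) (𝓡 4) ∞ ν.toFun :=
  ν.isSmoothEmbedding.contMDiff

/-- `ν (u, w)` lies on the core circle iff `w = 0`. [folklore] -/
theorem apply_mem_range_iff {u : 𝕊 1} {w : 𝔼 3} : ν.toFun (u, w) ∈ range c ↔ w = 0 := by
  constructor
  · rintro ⟨u', h⟩
    rw [← ν.apply_zero] at h
    exact (Prod.ext_iff.1 (ν.injective h)).2.symm
  · rintro rfl; exact ⟨u, (ν.apply_zero u).symm⟩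

/-- The tubular neighbourhood as an open partial homeomorphism `𝕊¹ × ℝ³ ⇀ X` (source `univ`,
target `range ν`). [folklore] -/
def toHomeo : OpenPartialHomeomorph ((𝕊 1) × (𝔼 3)) X := ν.isOpenEmbedding.toOpenPartialHomeomorph _

/-- The partial homeomorphism of `ν` is `ν` as a function. [folklore] -/
@[simp] theorem toHomeo_apply (q : (𝕊 1) × (𝔼 3)) : ν.toHomeo q = ν.toFun q := rfl

/-- The partial homeomorphism of `ν` is defined everywhere. [folklore] -/
@[simp] theorem toHomeo_source : ν.toHomeo.source = univ := by simp [toHomeo]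

/-- The target of the partial homeomorphism of `ν` is the (open) range of `ν`. [folklore] -/
@[simp] theorem toHomeo_target : ν.toHomeo.target = range ν.toFun := by simp [toHomeo]

/-- The inverse of the partial homeomorphism of `ν` is a left inverse of `ν`. [folklore] -/
theorem toHomeo_symm_apply (q : (𝕊 1) × (𝔼 3)) : ν.toHomeo.symm (ν.toFun q) = q :=
  ν.isOpenEmbedding.toOpenPartialHomeomorph_left_inv

/-- **The inverse of a tubular neighbourhood map is smooth on its range**
(`contMDiffOn_symm_of_isSmoothEmbedding`). [folklore] -/
theorem contMDiffOn_toHomeo_symm :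
    ContMDiffOn (𝓡 4) ((𝓡 1).prod 𝓘(ℝ, 𝔼 3)) ∞ ν.toHomeo.symm (range ν.toFun) :=
  contMDiffOn_symm_of_isSmoothEmbedding ν.isSmoothEmbedding ν.isOpenEmbedding

/-! #### The polar maps -/

/-- The **polar map** `(u, w) ↦ (‖w‖ • u, w / ‖w‖) : 𝕊¹ × ℝ³ → ℝ² × 𝕊²` (junk second component at
`w = 0`), the coordinate change of the surgery gluing. [folklore] -/
def polar (q : (𝕊 1) × (𝔼 3)) : (𝔼 2) × (𝕊 2) := (‖q.2‖ • (q.1 : 𝔼 2), radialProjection (spherePt 2) q.2)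

/-- The **inverse polar map** `(z, v) ↦ (z / ‖z‖, ‖z‖ • v) : ℝ² × 𝕊² → 𝕊¹ × ℝ³` (junk first
component at `z = 0`). [folklore] -/
def polarInv (p : (𝔼 2) × (𝕊 2)) : (𝕊 1) × (𝔼 3) :=
  (radialProjection (spherePt 1) p.1, ‖p.1‖ • (p.2 : 𝔼 3))

/-- `polarInv ∘ polar = id` off the zero section. [folklore] -/
theorem polarInv_polar {q : (𝕊 1) × (𝔼 3)} (hq : q.2 ≠ 0) : polarInv (polar q) = q := by
  obtain ⟨u, w⟩ := q
  simp only [polar, polarInv] at hq ⊢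
  rw [radialProjection_smul _ (norm_pos_iff.2 hq), norm_smul_coe_sphere (norm_nonneg _),
    norm_smul_coe_radialProjection]

/-- `polar ∘ polarInv = id` off the core sphere `{0} × 𝕊²`. [folklore] -/
theorem polar_polarInv {p : (𝔼 2) × (𝕊 2)} (hp : p.1 ≠ 0) : polar (polarInv p) = p := by
  obtain ⟨z, v⟩ := p
  simp only [polar, polarInv] at hp ⊢
  rw [norm_smul_coe_sphere (norm_nonneg _), norm_smul_coe_radialProjection,
    radialProjection_smul _ (norm_pos_iff.2 hp)]

/-- The disc coordinate of `polar (u, w)` has norm `‖w‖`. [folklore] -/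
theorem norm_polar_fst (q : (𝕊 1) × (𝔼 3)) : ‖(polar q).1‖ = ‖q.2‖ := by
  simp [polar, norm_smul_coe_sphere (norm_nonneg _)]

/-- `polarInv` of a point off the core sphere is off the zero section. [folklore] -/
theorem polarInv_snd_ne_zero {p : (𝔼 2) × (𝕊 2)} (hp : p.1 ≠ 0) : (polarInv p).2 ≠ 0 := by
  simp only [polarInv, ne_eq, smul_eq_zero, norm_eq_zero, hp, false_or]
  exact ne_zero_of_mem_unit_sphere p.2

/-- The fibre coordinate of `polarInv (z, v)` has norm `‖z‖`. [folklore] -/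
theorem norm_polarInv_snd (p : (𝔼 2) × (𝕊 2)) : ‖(polarInv p).2‖ = ‖p.1‖ := by
  simp [polarInv, norm_smul_coe_sphere (norm_nonneg _)]

/-- The polar map is smooth away from the zero section. [folklore] -/
theorem contMDiffOn_polar :
    ContMDiffOn ((𝓡 1).prod 𝓘(ℝ, 𝔼 3)) (𝓘(ℝ, 𝔼 2).prod (𝓡 2)) ∞ polar {q | q.2 ≠ 0} := by
  refine ContMDiffOn.prodMk ?_ ?_
  · intro q hq
    have h1 : ContMDiffAt ((𝓡 1).prod 𝓘(ℝ, 𝔼 3)) 𝓘(ℝ, ℝ) ∞ (fun q : (𝕊 1) × (𝔼 3) ↦ ‖q.2‖) q :=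
      (contDiffAt_norm ℝ hq).comp_contMDiffAt contMDiffAt_snd
    have h2 : ContMDiffAt ((𝓡 1).prod 𝓘(ℝ, 𝔼 3)) 𝓘(ℝ, 𝔼 2) ∞
        (fun q : (𝕊 1) × (𝔼 3) ↦ ((q.1 : 𝕊 1) : 𝔼 2)) q :=
      (contMDiff_coe_sphere (E := 𝔼 2) (n := 1)).contMDiffAt.comp q contMDiffAt_fst
    exact ((contDiff_fst (E := ℝ) (F := 𝔼 2).smul contDiff_snd).contDiffAt.comp_contMDiffAt
      (h1.prodMk_space h2)).contMDiffWithinAt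
  · exact (contMDiffOn_radialProjection _).comp contMDiff_snd.contMDiffOn fun q hq ↦ hq

/-- The inverse polar map is smooth away from `z = 0`. [folklore] -/
theorem contMDiffOn_polarInv :
    ContMDiffOn (𝓘(ℝ, 𝔼 2).prod (𝓡 2)) ((𝓡 1).prod 𝓘(ℝ, 𝔼 3)) ∞ polarInv {p | p.1 ≠ 0} := by
  refine ContMDiffOn.prodMk ?_ ?_
  · exact (contMDiffOn_radialProjection _).comp contMDiff_fst.contMDiffOn fun p hp ↦ hp
  · intro p hp
    have h1 : ContMDiffAt (𝓘(ℝ, 𝔼 2).prod (𝓡 2)) 𝓘(ℝ, ℝ) ∞ (fun p : (𝔼 2) × (𝕊 2) ↦ ‖p.1‖) p :=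
      (contDiffAt_norm ℝ hp).comp_contMDiffAt contMDiffAt_fst
    have h2 : ContMDiffAt (𝓘(ℝ, 𝔼 2).prod (𝓡 2)) 𝓘(ℝ, 𝔼 3) ∞
        (fun p : (𝔼 2) × (𝕊 2) ↦ ((p.2 : 𝕊 2) : 𝔼 3)) p :=
      (contMDiff_coe_sphere (E := 𝔼 3) (n := 2)).contMDiffAt.comp p contMDiffAt_snd
    exact ((contDiff_fst (E := ℝ) (F := 𝔼 3).smul contDiff_snd).contDiffAt.comp_contMDiffAt
      (h1.prodMk_space h2)).contMDiffWithinAt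

/-! #### The gluing maps -/

/-- The **punctured open tube** `ν(𝕊¹ × (B³ ∖ 0))`, the gluing region on the side of `X`. [folklore] -/
def puncturedTube : Set X := ν.toFun '' {q | q.2 ≠ 0 ∧ ‖q.2‖ < 1}

/-- The punctured tube is open. [folklore] -/
theorem isOpen_puncturedTube : IsOpen ν.puncturedTube := by
  refine ν.isOpenEmbedding.isOpenMap _ (IsOpen.inter ?_ ?_)
  · exact isOpen_ne.preimage continuous_snd
  · exact isOpen_lt (continuous_norm.comp continuous_snd) continuous_const

/-- The punctured tube lies in the range of `ν`. [folklore] -/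
theorem puncturedTube_subset_range : ν.puncturedTube ⊆ range ν.toFun := image_subset_range _ _

/-- `ν (u, w)` lies in the punctured tube iff `0 < ‖w‖ < 1`. [folklore] -/
theorem apply_mem_puncturedTube_iff {q : (𝕊 1) × (𝔼 3)} :
    ν.toFun q ∈ ν.puncturedTube ↔ q.2 ≠ 0 ∧ ‖q.2‖ < 1 :=
  ν.injective.mem_set_image

/-- The punctured tube misses the core circle. [folklore] -/
theorem puncturedTube_subset_compl_range : ν.puncturedTube ⊆ (range c)ᶜ := by
  rintro _ ⟨⟨u, w⟩, ⟨hw, -⟩, rfl⟩ h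
  exact hw (ν.apply_mem_range_iff.1 h)

/-- The forward gluing map at the level of `X`: `polar ∘ ν⁻¹` (junk off `range ν`). [folklore] -/
def fwdX (x : X) : (𝔼 2) × (𝕊 2) := polar (ν.toHomeo.symm x)

/-- The backward gluing map at the level of `ℝ² × 𝕊²`: `ν ∘ polarInv`. [folklore] -/
def bwdX (p : (𝔼 2) × (𝕊 2)) : X := ν.toFun (polarInv p)

/-- On the range of `ν`, the forward map is `polar ∘ ν⁻¹`. [folklore] -/
theorem fwdX_apply (q : (𝕊 1) × (𝔼 3)) : ν.fwdX (ν.toFun q) = polar q := by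
  rw [fwdX, toHomeo_symm_apply]

/-- The forward map `polar ∘ ν⁻¹` is smooth on the punctured tube. [folklore] -/
theorem contMDiffOn_fwdX :
    ContMDiffOn (𝓡 4) (𝓘(ℝ, 𝔼 2).prod (𝓡 2)) ∞ ν.fwdX ν.puncturedTube := by
  refine contMDiffOn_polar.comp (ν.contMDiffOn_toHomeo_symm.mono ν.puncturedTube_subset_range) ?_
  rintro _ ⟨q, hq, rfl⟩
  simp only [mem_preimage, toHomeo_symm_apply, mem_setOf_eq]
  exact hq.1

/-- The backward map `ν ∘ polarInv` is smooth off the core sphere. [folklore] -/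
theorem contMDiffOn_bwdX :
    ContMDiffOn (𝓘(ℝ, 𝔼 2).prod (𝓡 2)) (𝓡 4) ∞ ν.bwdX {p | p.1 ≠ 0} :=
  ν.contMDiff.comp_contMDiffOn contMDiffOn_polarInv

/-- A base point of `D̊² × 𝕊²` (junk value). [folklore] -/
def basePtB : ↥discTimesSphere := ⟨((0 : 𝔼 2), spherePt 2), by simp [mem_discTimesSphere_iff]⟩

/-- A fixed nonzero vector of norm `1/2` in `ℝ³`. [folklore] -/
def halfVec : 𝔼 3 := (2 : ℝ)⁻¹ • EuclideanSpace.single 0 1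

/-- `halfVec ≠ 0`. [folklore] -/
theorem halfVec_ne_zero : halfVec ≠ 0 := by
  simp [halfVec]

/-- The forward gluing map `X → D̊² × 𝕊²` (values in the open piece; junk where undefined). [folklore] -/
def fwdB (x : X) : ↥discTimesSphere := by
  classical
  exact if h : ν.fwdX x ∈ discTimesSphere then ⟨ν.fwdX x, h⟩ else basePtB

/-- The forward map sends `ν (u, w)`, `‖w‖ < 1`, into `D̊² × 𝕊²`. [folklore] -/
theorem fwdX_mem_discTimesSphere {q : (𝕊 1) × (𝔼 3)} (hq : ‖q.2‖ < 1) :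
    ν.fwdX (ν.toFun q) ∈ discTimesSphere := by
  rw [fwdX_apply, mem_discTimesSphere_iff, norm_polar_fst]; exact hq

/-- The forward map into `D̊² × 𝕊²` on the tube of radius `1` is `polar`. [folklore] -/
theorem coe_fwdB_apply {q : (𝕊 1) × (𝔼 3)} (hq : ‖q.2‖ < 1) :
    (ν.fwdB (ν.toFun q) : (𝔼 2) × (𝕊 2)) = polar q := by
  rw [fwdB, dif_pos (ν.fwdX_mem_discTimesSphere hq), Subtype.coe_mk, fwdX_apply]

variable [T2Space X]

/-- A base point of `X ∖ c(𝕊¹)` (junk value): `ν (e₀, w₀)` with `w₀ ≠ 0`. [folklore] -/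
def basePtA : ↥ν.complement :=
  ⟨ν.toFun (spherePt 1, halfVec), by
    rw [CircleNbhd.mem_complement_iff, ν.apply_mem_range_iff]; exact halfVec_ne_zero⟩

/-- The backward gluing map `ℝ² × 𝕊² → X ∖ c(𝕊¹)` (junk where undefined). [folklore] -/
def bwdA (p : (𝔼 2) × (𝕊 2)) : ↥ν.complement := by
  classical
  exact if h : ν.bwdX p ∈ ν.complement then ⟨ν.bwdX p, h⟩ else ν.basePtA

/-- The backward map lands in the complement of the core circle off the core sphere. [folklore] -/
theorem bwdX_mem_complement {p : (𝔼 2) × (𝕊 2)} (hp : p.1 ≠ 0) : ν.bwdX p ∈ ν.complement := by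
  rw [CircleNbhd.mem_complement_iff, bwdX, polarInv]
  rw [ν.apply_mem_range_iff]
  exact polarInv_snd_ne_zero hp

/-- The backward map into `X ∖ c` off the core sphere is `ν ∘ polarInv`. [folklore] -/
theorem coe_bwdA_apply {p : (𝔼 2) × (𝕊 2)} (hp : p.1 ≠ 0) :
    (ν.bwdA p : X) = ν.toFun (polarInv p) := by
  rw [bwdA, dif_pos (ν.bwdX_mem_complement hp)]; rfl

/-- The forward gluing map is smooth on the punctured tube (as a map into the open piece
`D̊² × 𝕊²`). [folklore] -/
theorem contMDiffOn_fwdB :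
    ContMDiffOn (𝓡 4) (𝓘(ℝ, 𝔼 2).prod (𝓡 2)) ∞ (fun a : ↥ν.complement ↦ ν.fwdB a)
      {a | (a : X) ∈ ν.puncturedTube} := by
  intro a ha
  refine (contMDiffAt_subtype_iff.2 ?_).contMDiffWithinAt
  rw [← ContMDiffAt.subtypeVal_comp_iff]
  have hev : (Subtype.val ∘ fun y ↦ ν.fwdB y) =ᶠ[𝓝 (a : X)] ν.fwdX := by
    filter_upwards [ν.isOpen_puncturedTube.mem_nhds ha]
    rintro _ ⟨q, hq, rfl⟩
    simp only [Function.comp_apply]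
    rw [ν.coe_fwdB_apply hq.2, fwdX_apply]
  exact ((ν.contMDiffOn_fwdX.contMDiffAt (ν.isOpen_puncturedTube.mem_nhds ha)).congr_of_eventuallyEq
    hev)

/-- The backward gluing map is smooth off `z = 0` (as a map into the open piece `X ∖ c`). [folklore] -/
theorem contMDiffOn_bwdA :
    ContMDiffOn (𝓘(ℝ, 𝔼 2).prod (𝓡 2)) (𝓡 4) ∞ (fun b : ↥discTimesSphere ↦ ν.bwdA b)
      {b | (b : (𝔼 2) × (𝕊 2)).1 ≠ 0} := by
  intro b hb
  refine (contMDiffAt_subtype_iff.2 ?_).contMDiffWithinAt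
  rw [← ContMDiffAt.subtypeVal_comp_iff]
  have ho : IsOpen {p : (𝔼 2) × (𝕊 2) | p.1 ≠ 0} := isOpen_ne.preimage continuous_fst
  have hev : (Subtype.val ∘ fun y ↦ ν.bwdA y) =ᶠ[𝓝 (b : (𝔼 2) × (𝕊 2))] ν.bwdX := by
    filter_upwards [ho.mem_nhds hb] with p hp
    simp only [Function.comp_apply]
    rw [ν.coe_bwdA_apply hp]; rfl
  exact (ν.contMDiffOn_bwdX.contMDiffAt (ho.mem_nhds hb)).congr_of_eventuallyEq hev

/-- **The gluing partial diffeomorphism of a circle surgery**: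
`ν(u, w) ↦ (‖w‖ • u, w / ‖w‖)` from the punctured tube `ν(𝕊¹ × (B³ ∖ 0)) ⊆ X ∖ c` onto
`(D̊² ∖ 0) × 𝕊² ⊆ D̊² × 𝕊²` (Gompf–Stipsicz (1999), §5.2). [folklore] -/
def glue : OpenPartialHomeomorph (↥ν.complement) (↥discTimesSphere) where
  toFun a := ν.fwdB a
  invFun b := ν.bwdA b
  source := {a : ↥ν.complement | (a : X) ∈ ν.puncturedTube}
  target := {b : ↥discTimesSphere | (b : (𝔼 2) × (𝕊 2)).1 ≠ 0}
  map_source' := by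
    rintro ⟨_, ha'⟩ ⟨q, hq, rfl⟩
    show (ν.fwdB (ν.toFun q) : (𝔼 2) × (𝕊 2)).1 ≠ 0
    rw [ν.coe_fwdB_apply hq.2, ← norm_ne_zero_iff, norm_polar_fst, norm_ne_zero_iff]
    exact hq.1
  map_target' := by
    intro b hb
    show (ν.bwdA b : X) ∈ ν.puncturedTube
    rw [ν.coe_bwdA_apply hb, apply_mem_puncturedTube_iff, norm_polarInv_snd]
    exact ⟨polarInv_snd_ne_zero hb, b.2⟩
  left_inv' := by
    rintro ⟨_, ha'⟩ ⟨q, hq, rfl⟩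
    ext1
    have h1 : (ν.fwdB (ν.toFun q) : (𝔼 2) × (𝕊 2)).1 ≠ 0 := by
      rw [ν.coe_fwdB_apply hq.2, ← norm_ne_zero_iff, norm_polar_fst, norm_ne_zero_iff]; exact hq.1
    show (ν.bwdA (ν.fwdB (ν.toFun q)) : X) = ν.toFun q
    rw [ν.coe_bwdA_apply h1, ν.coe_fwdB_apply hq.2, polarInv_polar hq.1]
  right_inv' := by
    intro b hb
    ext1
    show (ν.fwdB (ν.bwdA b) : (𝔼 2) × (𝕊 2)) = b
    rw [ν.coe_bwdA_apply hb, ν.coe_fwdB_apply (by rw [norm_polarInv_snd]; exact b.2),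
      polar_polarInv hb]
  open_source := ν.isOpen_puncturedTube.preimage continuous_subtype_val
  open_target := (isOpen_ne.preimage continuous_fst).preimage continuous_subtype_val
  continuousOn_toFun := ν.contMDiffOn_fwdB.continuousOn
  continuousOn_invFun := ν.contMDiffOn_bwdA.continuousOn

/-- The source of the gluing map is the punctured tube. [folklore] -/
theorem glue_source : ν.glue.source = {a : ↥ν.complement | (a : X) ∈ ν.puncturedTube} := rfl

/-- The target of the gluing map is the complement of the core sphere. [folklore] -/
theorem glue_target : ν.glue.target = {b : ↥discTimesSphere | (b : (𝔼 2) × (𝕊 2)).1 ≠ 0} := rfl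

/-- The gluing map is the forward map. [folklore] -/
theorem glue_apply (a : ↥ν.complement) : ν.glue a = ν.fwdB a := rfl

/-- The inverse gluing map is the backward map. [folklore] -/
theorem glue_symm_apply (b : ↥discTimesSphere) : ν.glue.symm b = ν.bwdA b := rfl

/-- The identification `ℝ² × ℝ² ≃L ℝ⁴` of the model vector spaces (equal dimension). [folklore] -/
def linB : ((𝔼 2) × (𝔼 2)) ≃L[ℝ] 𝔼 4 :=
  ContinuousLinearEquiv.ofFinrankEq (by simp)

/-- **The gluing datum of a circle surgery** along the tubular neighbourhood `ν`. [folklore] -/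
def glueData : SmoothGlueData (𝓡 4) (𝓘(ℝ, 𝔼 2).prod (𝓡 2)) (↥ν.complement) (↥discTimesSphere) (𝔼 4) where
  glue := ν.glue
  contMDiffOn_glue := ν.contMDiffOn_fwdB
  contMDiffOn_glue_symm := ν.contMDiffOn_bwdA
  linA := ContinuousLinearEquiv.refl ℝ (𝔼 4)
  linB := linB

/-- The gluing map of the surgery datum is `ν.glue`. [folklore] -/
@[simp] theorem glueData_glue : ν.glueData.glue = ν.glue := rfl

/-- **The gluing datum realises `circleSurgeryRel`.** [folklore] -/
theorem circleSurgeryRel_iff (a : ↥ν.complement) (b : ↥discTimesSphere) :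
    circleSurgeryRel ν a b ↔ a ∈ ν.glueData.glue.source ∧ ν.glueData.glue a = b := by
  change circleSurgeryRel ν a b ↔ (a : X) ∈ ν.puncturedTube ∧ ν.fwdB a = b
  constructor
  · rintro ⟨u, t, ht, hb1, ha⟩
    have hq : ((u, t • ((b : (𝔼 2) × (𝕊 2)).2 : 𝔼 3)) : (𝕊 1) × (𝔼 3)).2 ≠ 0 ∧
        ‖((u, t • ((b : (𝔼 2) × (𝕊 2)).2 : 𝔼 3)) : (𝕊 1) × (𝔼 3)).2‖ < 1 := by
      simp only [norm_smul_coe_sphere ht.1.le, ne_eq, smul_eq_zero, ht.1.ne', false_or]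
      exact ⟨ne_zero_of_mem_unit_sphere _, ht.2⟩
    refine ⟨ha ▸ (ν.apply_mem_puncturedTube_iff.2 hq), ?_⟩
    ext1
    rw [ha, ν.coe_fwdB_apply hq.2, polar]
    ext1
    · simp only [norm_smul_coe_sphere ht.1.le]; exact hb1.symm
    · exact radialProjection_smul _ ht.1 _
  · rintro ⟨⟨⟨u, w⟩, ⟨hw0, hw1⟩, ha⟩, hb⟩
    refine ⟨u, ‖w‖, ⟨norm_pos_iff.2 hw0, hw1⟩, ?_, ?_⟩
    · rw [← hb, ← ha, ν.coe_fwdB_apply hw1, polar]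
    · rw [← hb, ← ha, ν.coe_fwdB_apply hw1, polar]
      simp only
      rw [norm_smul_coe_radialProjection]

/-- The parametrisation `(u, t, v) ↦ (ν(u, t • v), (t • u, v))` of the closure of the graph of the
gluing map by the compact space `𝕊¹ × [0, 1] × 𝕊²`. [folklore] -/
def graphParam (r : (𝕊 1) × (Icc (0 : ℝ) 1) × (𝕊 2)) : X × ((𝔼 2) × (𝕊 2)) :=
  (ν.toFun (r.1, (r.2.1 : ℝ) • (r.2.2 : 𝔼 3)), ((r.2.1 : ℝ) • (r.1 : 𝔼 2), r.2.2))

omit [T2Space X] in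
/-- The parametrisation of the closure of the graph is continuous. [folklore] -/
theorem continuous_graphParam : Continuous ν.graphParam := by
  unfold graphParam
  have := ν.isOpenEmbedding.continuous
  fun_prop

/-- **The graph of the gluing map is closed** in `(X ∖ c) × (D̊² × 𝕊²)`: it is the trace of the
compact set `graphParam (𝕊¹ × [0,1] × 𝕊²)`, whose extra points (`t = 0`: on the core circle;
`t = 1`: on `∂D² × 𝕊²`) lie outside the two open pieces. This is the Hausdorff condition of the
surgery pushout. [folklore] -/
theorem isClosed_graph : IsClosed {p : ↥ν.complement × ↥discTimesSphere |
    p.1 ∈ ν.glueData.glue.source ∧ ν.glueData.glue p.1 = p.2} := by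
  have hc : IsClosed (range ν.graphParam) :=
    (isCompact_range ν.continuous_graphParam).isClosed
  have hcont : Continuous fun p : ↥ν.complement × ↥discTimesSphere ↦
      ((p.1 : X), (p.2 : (𝔼 2) × (𝕊 2))) := by fun_prop
  convert hc.preimage hcont using 1
  ext ⟨a, b⟩
  rw [mem_setOf_eq, ← circleSurgeryRel_iff]
  simp only [mem_preimage, mem_range]
  constructor
  · rintro ⟨u, t, ht, hb1, ha⟩
    refine ⟨(u, ⟨t, ht.1.le, ht.2.le⟩, (b : (𝔼 2) × (𝕊 2)).2), ?_⟩
    simp only [graphParam, Prod.mk.injEq]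
    exact ⟨ha.symm, Prod.ext hb1.symm rfl⟩
  · rintro ⟨⟨u, ⟨t, ht0, ht1⟩, v⟩, h⟩
    simp only [graphParam, Prod.mk.injEq] at h
    obtain ⟨ha, hb⟩ := h
    have ht0' : 0 < t := by
      rcases ht0.lt_or_eq with h | rfl
      · exact h
      · exfalso
        have : (a : X) ∈ range c := by rw [← ha, ν.apply_mem_range_iff]; simp
        exact a.2 this
    have ht1' : t < 1 := by
      rcases ht1.lt_or_eq with h | rfl
      · exact h
      · exfalso
        have hb2 := b.2
        rw [mem_discTimesSphere_iff, ← hb] at hb2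
        simp at hb2
    refine ⟨u, t, ⟨ht0', ht1'⟩, ?_, ?_⟩
    · rw [← hb]
    · rw [← ha, ← hb]

/-- The compact set `X ∖ ν(𝕊¹ × B³_{1/2})`, seen in `X ∖ c`. [folklore] -/
def cptA : Set ↥ν.complement := {a | (a : X) ∉ ν.toFun '' {q | ‖q.2‖ < 2⁻¹}}

/-- The compact set `D²_{1/2} × 𝕊²`, seen in `D̊² × 𝕊²`. [folklore] -/
def cptB : Set ↥discTimesSphere := {b | ‖(b : (𝔼 2) × (𝕊 2)).1‖ ≤ 2⁻¹}

/-- `X ∖ ν(𝕊¹ × B³_{1/2})` is compact (for compact `X`). [folklore] -/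
theorem isCompact_cptA [CompactSpace X] : IsCompact ν.cptA := by
  have hopen : IsOpen (ν.toFun '' {q : (𝕊 1) × (𝔼 3) | ‖q.2‖ < 2⁻¹}) :=
    ν.isOpenEmbedding.isOpenMap _ (isOpen_lt (continuous_norm.comp continuous_snd) continuous_const)
  refine Topology.IsInducing.subtypeVal.isCompact_preimage' hopen.isClosed_compl.isCompact ?_
  intro x hx
  refine ⟨⟨x, ?_⟩, rfl⟩
  show x ∈ (Set.range c)ᶜ
  rintro ⟨u, rfl⟩
  exact hx ⟨(u, 0), by simp, ν.apply_zero u⟩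

omit [T2Space X] in
/-- `D²_{1/2} × 𝕊²` is compact. [folklore] -/
theorem isCompact_cptB : IsCompact cptB := by
  have h : cptB = ((↑) : ↥discTimesSphere → (𝔼 2) × (𝕊 2)) ⁻¹' (closedBall (0 : 𝔼 2) 2⁻¹ ×ˢ univ) := by
    ext b; simp [cptB]
  rw [h]
  refine Topology.IsInducing.subtypeVal.isCompact_preimage'
    ((isCompact_closedBall _ _).prod isCompact_univ) ?_
  rintro ⟨z, v⟩ ⟨hz, -⟩
  rw [mem_closedBall, dist_zero_right] at hz
  have hz' : ((z, v) : (𝔼 2) × (𝕊 2)) ∈ discTimesSphere := by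
    rw [mem_discTimesSphere_iff]; exact hz.trans_lt (by norm_num)
  exact ⟨⟨(z, v), hz'⟩, rfl⟩

/-- A point of `X ∖ c` outside `X ∖ ν(𝕊¹ × B³_{1/2})` is glued to a point of `D²_{1/2} × 𝕊²`. [folklore] -/
theorem forall_not_mem_cptA (a : ↥ν.complement) (ha : a ∉ ν.cptA) :
    a ∈ ν.glue.source ∧ ν.glue a ∈ cptB := by
  simp only [cptA, mem_setOf_eq, not_not] at ha
  obtain ⟨⟨u, w⟩, hw, hwa⟩ := ha
  have hw' : ‖w‖ < 2⁻¹ := hw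
  have hw0 : w ≠ 0 := by
    rintro rfl
    exact a.2 ⟨u, by rw [← hwa, ν.apply_zero]⟩
  have hw1 : ‖w‖ < 1 := hw'.trans (by norm_num)
  constructor
  · rw [glue_source, mem_setOf_eq, ← hwa, apply_mem_puncturedTube_iff]
    exact ⟨hw0, hw1⟩
  · rw [cptB, mem_setOf_eq, glue_apply]
    have : (ν.fwdB a : (𝔼 2) × (𝕊 2)) = polar (u, w) := by rw [← hwa]; exact ν.coe_fwdB_apply hw1
    rw [this, norm_polar_fst]
    exact hw'.le

/-- A point of `D̊² × 𝕊²` outside `D²_{1/2} × 𝕊²` is glued to a point of `X ∖ ν(𝕊¹ × B³_{1/2})`. [folklore] -/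
theorem forall_not_mem_cptB (b : ↥discTimesSphere) (hb : b ∉ cptB) :
    b ∈ ν.glue.target ∧ ν.glue.symm b ∈ ν.cptA := by
  simp only [cptB, mem_setOf_eq, not_le] at hb
  have hb0 : (b : (𝔼 2) × (𝕊 2)).1 ≠ 0 := by
    rw [← norm_pos_iff]; exact hb.trans' (by norm_num)
  refine ⟨hb0, ?_⟩
  rw [cptA, mem_setOf_eq, glue_symm_apply, ν.coe_bwdA_apply hb0, ν.injective.mem_set_image]
  simp only [mem_setOf_eq, norm_polarInv_snd, not_lt]
  exact hb.le

variable [IsManifold (𝓡 4) ∞ X]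

/-- **The surgered manifold** `P = (X ∖ ν(𝕊¹ × B³)) ∪_{𝕊¹ × 𝕊²} (D² × 𝕊²)`, as the glued space of the
surgery gluing datum (Gompf–Stipsicz (1999), §5.2). [folklore] -/
abbrev Surgered : Type u := ν.glueData.Glued

/-- The surgered manifold is Hausdorff (closed graph of the gluing map). [folklore] -/
instance t2Space_surgered : T2Space ν.Surgered := ν.glueData.t2Space_of_isClosed_graph ν.isClosed_graph

/-- The surgered manifold of a compact manifold is compact. [folklore] -/
instance compactSpace_surgered [CompactSpace X] : CompactSpace ν.Surgered :=
  ν.glueData.compactSpace_of_forall_not_mem ν.isCompact_cptA isCompact_cptB ν.forall_not_mem_cptA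
    ν.forall_not_mem_cptB

/-- The surgered manifold of a compact manifold is second countable. [folklore] -/
instance secondCountable_surgered [CompactSpace X] : SecondCountableTopology ν.Surgered :=
  ν.glueData.secondCountableTopology

/-- The surgered manifold is an open gluing of `X ∖ c` and `D̊² × 𝕊²` along `circleSurgeryRel ν`. [folklore] -/
theorem isOpenGluing_surgered :
    IsOpenGluing (𝓡 4) (𝓘(ℝ, 𝔼 2).prod (𝓡 2)) (𝓡 4) (A := ↥ν.complement) (B := ↥discTimesSphere)
      (P := ν.Surgered) (circleSurgeryRel ν) :=
  ν.glueData.isOpenGluing ν.circleSurgeryRel_iff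

end CircleNbhd

end Datum

/-- **Circle surgery along a given tubular neighbourhood exists** (explicit form of the named fact
`Literature.Topology.FourManifolds.exists_isOpenGluing_circleSurgeryRel` of `CircleSurgeryProofs`, discharged there): for a
tubular neighbourhood `ν` of a circle `c` in a closed smooth 4-manifold `X` there is a closed
smooth 4-manifold `P` which is an open gluing of `X ∖ c` and `D̊² × 𝕊²` along
`circleSurgeryRel ν` — the pushout `(X ∖ c) ∪_glue (D̊² × 𝕊²)` (`SmoothGlueData.Glued`) along the
polar identification `ν(u, w) ↦ (‖w‖ • u, w/‖w‖)`; it is Hausdorff by `CircleNbhd.isClosed_graph`,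
compact by the cover `X ∖ ν(𝕊¹ × B³_{1/2})`, `D²_{1/2} × 𝕊²`, second countable and smooth by the
generic gluing construction (Gompf–Stipsicz (1999), §5.2, surgery on an embedded circle with a
chosen framing; Kosinski (1993), VI.1–2). [cite: GompfStipsicz1999, §5.2] -/
theorem CircleNbhd.surgery_exists {X : Type u} [TopologicalSpace X] [T2Space X]
    [SecondCountableTopology X] [CompactSpace X] [ChartedSpace (𝔼 4) X] [IsManifold (𝓡 4) ∞ X]
    {c : 𝕊 1 → X} (ν : CircleNbhd (𝓡 4) c) :
    ∃ (P : Type u) (_ : TopologicalSpace P) (_ : T2Space P) (_ : SecondCountableTopology P)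
      (_ : ChartedSpace (𝔼 4) P) (_ : IsManifold (𝓡 4) ∞ P) (_ : CompactSpace P),
      IsOpenGluing (𝓡 4) (𝓘(ℝ, 𝔼 2).prod (𝓡 2)) (𝓡 4) (A := ν.complement) (B := ↥discTimesSphere)
        (P := P) (circleSurgeryRel ν) :=
  ⟨ν.Surgered, inferInstance, inferInstance, inferInstance, inferInstance, inferInstance,
    inferInstance, ν.isOpenGluing_surgered⟩

end Literature.Topology.FourManifolds
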